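import Literature.Analysis.Complex.WeightedArgumentPrinciple
import Literature.Analysis.Complex.RectangleResidueSimplePoles
import Literature.Analysis.Complex.LittlewoodLemma
import Mathlib.Analysis.SpecialFunctions.Trigonometric.Complex
import Mathlib.Analysis.Complex.RemovableSingularity
import Mathlib.Analysis.SpecialFunctions.Trigonometric.DerivHyp
import HarnessLib

/-!
# Ford's zero detector on a rectangle (Ford 2002, Lemma 2.2, finite form)

Trunk T-ANALYSIS support (`Literature/Analysis/Complex`). Everything in this file is PROVED; no
named fact is introduced.

K. Ford's "zero detector" (*Zero-free regions for the Riemann zeta function*, 2002, Lemma 2.2) is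
the identity behind the explicit Vinogradov–Korobov zero-free regions of Ford (2002) and of
Mossinghoff–Trudgian–Yang (2024, Lemmas 4.1, 4.7, 6.1): for `f` meromorphic of finite order,
`z₀` neither a zero nor a pole, and almost every `η > 0`,

  `−Re f'(z₀)/f(z₀) = (π/2η) Σ_{|Re(z₀−ρ)| ≤ η} m_ρ Re cot(π(ρ − z₀)/2η)`
  `    + (1/4η) ∫_{−∞}^{∞} [log|f(z₀ − η + 2ηiu/π)| − log|f(z₀ + η + 2ηiu/π)|] sech²u du`.

Ford proves it by integrating `(f'/f)(z + z₀) h(z)`, `h(z) = (π/2η) cot(πz/2η)`, over the boundary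
of the rectangle `|Re z| ≤ η`, `|Im z| ≤ T` (residues: `f'/f(z₀)` from the pole of `h`, `m_ρ h(ρ − z₀)`
from the zeros), integrating by parts against a branch of `log f` (the cut at `z = η`, where
`h = 0`), taking real parts — on the vertical sides `h' = −(π/2η)² sech²` is real, so only `log|f|`
survives — and letting `T → ∞` (on the horizontal sides `h'` is exponentially small).

This file proves the **finite-rectangle form** of the identity for an arbitrary function analytic
on a closed rectangle `[x₀ − η, x₀ + η] × [c, d]` (`c < y₀ < d`), non-zero on its boundary and at
`z₀ = x₀ + iy₀`, in a branch-free formulation (the edge primitives of `f'/f` replace `log f`, as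
in the tree's `Literature.Analysis.Complex.littlewood_lemma`):

* `Literature.Analysis.Complex.FordDetector.ford_zero_detector_rect` —
  `−Re (f'/f)(z₀) = Σ_{ρ ∈ K°} m(ρ) Re h_η(ρ − z₀)`
  `  + (π/8η²) ∫_c^d [log|f(x₀−η+iy)| − log|f(x₀+η+iy)|] sech²(π(y−y₀)/2η) dy − (Im H(d) − Im H(c))/2π`,
  where `H(y) = ∫_{x₀−η}^{x₀+η} Λ_y(x) h_η'(x + iy − z₀) dx`, `Λ_y(x) = ∫_{x₀−η}^x (f'/f)(u + iy) du`
  (`fordHorizontalTerm`), the only terms depending on the horizontal edges;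
* `Literature.Analysis.Complex.FordDetector.norm_fordHorizontalTerm_le` —
  `‖H(y)‖ ≤ (2η)² · max|f'/f| · (π/2η)²/sinh²(π(y − y₀)/2η)`, i.e. the horizontal terms vanish as
  the horizontal edges recede whenever `max|f'/f| = e^{o(|y|/η)}` there (for `ζ`: good heights);
* `Literature.Analysis.Complex.FordDetector.rectBoundaryIntegral_logDeriv_mul_fordCot` — the
  residue step `∮_{∂K} (f'/f) h_η(· − z₀) = 2πi[(f'/f)(z₀) + Σ m(ρ) h_η(ρ − z₀)]` on any rectangle
  of width `≤ 2η` (from the tree's residue theorem for simple poles,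
  `Literature.Analysis.Complex.rectBoundaryIntegral_eq_sum_of_simplePoles`, with the local
  structure `f'/f = ψ/(z−ρ)`, `ψ(ρ) = m`, `logDeriv_eq_div_sub_near`, and `h_η = H_η/w`,
  `H_η(0) = 1`, `fordCot_eq_fordCotReg_div`);
* the kernel facts used downstream: `h_η(±η + iv) = −i(π/2η) tanh(πv/2η)` (`fordCot_eta_add`,
  `fordCot_neg_eta_add`), `h_η'(±η + iv) = −(π/2η)² sech²(πv/2η)` (`fordCotDeriv_eta_add`,
  `fordCotDeriv_neg_eta_add`), `‖h_η'(u + iV)‖ ≤ (π/2η)²/sinh²(πV/2η)` (`norm_fordCotDeriv_le`),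
  `Re h_η(w) ≤ 0` for `−η ≤ Re w ≤ 0` (`re_fordCot_nonpos`, Ford's remark in the proof of his
  Lemma 4.1 that zeros may be dropped from the upper bound) and `Re h_η(iy) = 0`
  (`re_fordCot_of_re_eq_zero`: a pole or zero straight below/above `z₀` contributes nothing);
* integration by parts along an edge against an arbitrary analytic weight
  (`integral_mul_eq_sub_horizontal`, `integral_mul_eq_sub_vertical`), extending the tree's
  `integral_mul_weight_horizontal/vertical` (weight `z − a`).

Passing to `c → −∞`, `d → +∞` for `f = ζ` (or `(s−1)ζ(s)`), with the tree's bounds for `ζ'/ζ` at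
good heights, gives Ford's Lemma 2.2 / 4.1 for `ζ`; that step is number theory and is left to
`Literature/NumberTheory/LFunctions`.

## Proof of the main identity

With `F = f'/f`, `g = h_η(· − z₀)` and the four-term boundary convention, the residue step gives
`Im ∮ F g = 2π[Re F(z₀) + Σ m Re g(ρ)]`. Integrate by parts on each edge against the primitive of
`F` from the edge's first corner. On the vertical edges `g(x₀ ± η + iy) = −iθ(y)`,
`θ(y) = (π/2η) tanh(π(y−y₀)/2η)`, and `g' = −k(y)`, `k = θ' = (π/2η)² sech²`, are the same on both
sides; `Re`/`Im` of the edge primitives are differences of `log|f|`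
(`re_integral_logDeriv_horizontal`, `im_integral_logDeriv_vertical`). The corner terms add up to
`(θ(d) − θ(c)) · [log|f(b+ic)| − log|f(a+ic)|]`, which cancels exactly against the constants of the
vertical primitives because `∫_c^d k = θ(d) − θ(c)`; what is left is
`−∫_c^d k(y)[log|f(a+iy)| − log|f(b+iy)|] dy + Im H(d) − Im H(c)`.

## References

* K. Ford, *Zero-free regions for the Riemann zeta function*, in: Number Theory for the Millennium
  II (Urbana, IL, 2000), A K Peters, 2002, 25–56 (arXiv:1910.08205), §2, Lemmas 2.1–2.2.
  [Ford2002Millennium]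
* M. J. Mossinghoff, T. S. Trudgian, A. Yang, *Explicit zero-free regions for the Riemann
  zeta-function*, Res. Number Theory 10 (2024), Lemma 4.1. [MossinghoffTrudgianYangRNT2024]
* J. B. Conway, *Functions of One Complex Variable I*, GTM 11, Ch. V (residue theorem).
  [Conway1978]
-/

noncomputable section

open Complex Set MeasureTheory Filter Topology intervalIntegral
open scoped Real

namespace Literature.Analysis.Complex

namespace FordDetector

/-! ### The kernel `h(z) = (π/2η) cot(πz/(2η))` -/

/-- Ford's kernel `h_η(z) = (π/2η) cot(πz/2η)`: meromorphic and odd, with simple poles of residue `1`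
at the points of `2ηℤ` and zeros at `±η`. [cite: Ford2002Millennium, §2, proof of Lemma 2.2] -/
def fordCot (η : ℝ) (z : ℂ) : ℂ :=
  ((π / (2 * η) : ℝ) : ℂ) * Complex.cot (((π / (2 * η) : ℝ) : ℂ) * z)

/-- The derivative `h_η'(z) = −(π/2η)² csc²(πz/2η)` of Ford's kernel.
[cite: Ford2002Millennium, §2, proof of Lemma 2.2] -/
def fordCotDeriv (η : ℝ) (z : ℂ) : ℂ :=
  -((π / (2 * η) : ℝ) : ℂ) ^ 2 / Complex.sin (((π / (2 * η) : ℝ) : ℂ) * z) ^ 2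

variable {η : ℝ}

/-- `h_η' ` is the derivative of `h_η` away from the poles. [folklore] -/
theorem hasDerivAt_fordCot {z : ℂ} (hz : Complex.sin (((π / (2 * η) : ℝ) : ℂ) * z) ≠ 0) :
    HasDerivAt (fordCot η) (fordCotDeriv η z) z := by
  set ν : ℂ := ((π / (2 * η) : ℝ) : ℂ) with hν
  have h1 : HasDerivAt (fun w : ℂ ↦ ν * w) ν z := by
    simpa using (hasDerivAt_id z).const_mul ν
  have hc : HasDerivAt (fun w : ℂ ↦ Complex.cos (ν * w)) (-Complex.sin (ν * z) * ν) z :=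
    (Complex.hasDerivAt_cos (ν * z)).comp z h1
  have hs : HasDerivAt (fun w : ℂ ↦ Complex.sin (ν * w)) (Complex.cos (ν * z) * ν) z :=
    (Complex.hasDerivAt_sin (ν * z)).comp z h1
  have hq := (hc.div hs hz).const_mul ν
  have hfun : (fun w : ℂ ↦ ν * ((fun w ↦ Complex.cos (ν * w)) / fun w ↦ Complex.sin (ν * w)) w) =
      fordCot η := by
    ext w; simp [fordCot, Complex.cot_eq_cos_div_sin, hν]
  rw [hfun] at hq
  refine hq.congr_deriv ?_
  have hpy := Complex.sin_sq_add_cos_sq (ν * z)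
  have e : fordCotDeriv η z = -ν ^ 2 / Complex.sin (ν * z) ^ 2 := rfl
  rw [e]
  field_simp
  linear_combination (-(ν ^ 2)) * hpy

/-- The only zero of `sin(πw/2η)` with `|Re w| < 2η` is `w = 0` (`η > 0`). [folklore] -/
theorem sin_ne_zero_of_abs_re_lt (hη : 0 < η) {w : ℂ} (hw : w ≠ 0) (hre : |w.re| < 2 * η) :
    Complex.sin (((π / (2 * η) : ℝ) : ℂ) * w) ≠ 0 := by
  rw [Complex.sin_ne_zero_iff]
  intro k hk
  have hν : (0 : ℝ) < π / (2 * η) := by positivity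
  have hre' := congrArg Complex.re hk
  simp only [mul_re, ofReal_re, ofReal_im, zero_mul, sub_zero, intCast_re, intCast_im] at hre'
  -- hre' : π/(2η) * w.re = k * π
  have habs : |(k : ℝ)| * π = π / (2 * η) * |w.re| := by
    rw [← abs_of_pos Real.pi_pos, ← abs_mul, ← hre', abs_mul, abs_of_pos hν, abs_of_pos Real.pi_pos]
  have hlt : |(k : ℝ)| < 1 := by
    have h1 : π / (2 * η) * |w.re| < π / (2 * η) * (2 * η) := mul_lt_mul_of_pos_left hre hν
    rw [div_mul_cancel₀ _ (by positivity : (2 * η : ℝ) ≠ 0)] at h1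
    nlinarith [Real.pi_pos, abs_nonneg (k : ℝ)]
  have hk0 : k = 0 := by
    have : |k| < 1 := by exact_mod_cast hlt
    exact Int.abs_lt_one_iff.mp this
  rw [hk0, Int.cast_zero, zero_mul, mul_eq_zero] at hk
  rcases hk with h | h
  · exact absurd h (by exact_mod_cast hν.ne')
  · exact hw h

/-- `(π/2η)·η = π/2`. [folklore] -/
theorem nu_mul_eta (hη : η ≠ 0) : ((π / (2 * η) : ℝ) : ℂ) * η = π / 2 := by
  have : (π / (2 * η) * η : ℝ) = π / 2 := by field_simp
  rw [← ofReal_mul, this]; push_cast; ring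

/-- On the vertical lines `Re z = ±η`: `h_η(±η + iv) = −i (π/2η) tanh(πv/2η)` (purely imaginary, the
same value on both lines). [folklore] -/
theorem fordCot_eta_add (hη : η ≠ 0) (v : ℝ) :
    fordCot η (η + v * I) = -(((π / (2 * η) * Real.tanh (π / (2 * η) * v) : ℝ) : ℂ)) * I := by
  set ν : ℝ := π / (2 * η) with hν
  have harg : ((ν : ℝ) : ℂ) * (η + v * I) = ((ν * v : ℝ) : ℂ) * I + π / 2 := by
    rw [mul_add, nu_mul_eta hη]; push_cast; ring
  rw [fordCot, harg, Complex.cot_eq_cos_div_sin, Complex.cos_add_pi_div_two, Complex.sin_add_pi_div_two,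
    Complex.sin_mul_I, Complex.cos_mul_I, ← ofReal_sinh, ← ofReal_cosh]
  have hc : (Real.cosh (ν * v) : ℂ) ≠ 0 := by exact_mod_cast (Real.cosh_pos _).ne'
  have hη' : (η : ℂ) ≠ 0 := by exact_mod_cast hη
  rw [Real.tanh_eq_sinh_div_cosh]
  simp only [hν] at hc ⊢
  push_cast
  field_simp

/-- `h_η(−η + iv) = −i (π/2η) tanh(πv/2η)`. [folklore] -/
theorem fordCot_neg_eta_add (hη : η ≠ 0) (v : ℝ) :
    fordCot η (-η + v * I) = -(((π / (2 * η) * Real.tanh (π / (2 * η) * v) : ℝ) : ℂ)) * I := by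
  set ν : ℝ := π / (2 * η) with hν
  have harg : ((ν : ℝ) : ℂ) * (-η + v * I) = ((ν * v : ℝ) : ℂ) * I - π / 2 := by
    rw [mul_add, mul_neg, nu_mul_eta hη]; push_cast; ring
  rw [fordCot, harg, Complex.cot_eq_cos_div_sin, Complex.cos_sub_pi_div_two, Complex.sin_sub_pi_div_two,
    Complex.sin_mul_I, Complex.cos_mul_I, ← ofReal_sinh, ← ofReal_cosh]
  have hc : (Real.cosh (ν * v) : ℂ) ≠ 0 := by exact_mod_cast (Real.cosh_pos _).ne'
  have hη' : (η : ℂ) ≠ 0 := by exact_mod_cast hη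
  rw [Real.tanh_eq_sinh_div_cosh]
  simp only [hν] at hc ⊢
  push_cast
  field_simp

/-- On the vertical lines `Re z = ±η`: `h_η'(±η + iv) = −(π/2η)² sech²(πv/2η)` (real, `< 0`).
[folklore] -/
theorem fordCotDeriv_eta_add (hη : η ≠ 0) (v : ℝ) :
    fordCotDeriv η (η + v * I) = -((((π / (2 * η)) ^ 2 / Real.cosh (π / (2 * η) * v) ^ 2 : ℝ) : ℂ)) := by
  set ν : ℝ := π / (2 * η) with hν
  have harg : ((ν : ℝ) : ℂ) * (η + v * I) = ((ν * v : ℝ) : ℂ) * I + π / 2 := by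
    rw [mul_add, nu_mul_eta hη]; push_cast; ring
  rw [fordCotDeriv, harg, Complex.sin_add_pi_div_two, Complex.cos_mul_I, ← ofReal_cosh]
  have hη' : (η : ℂ) ≠ 0 := by exact_mod_cast hη
  have hc : (Real.cosh (ν * v) : ℂ) ≠ 0 := by exact_mod_cast (Real.cosh_pos _).ne'
  simp only [hν] at hc ⊢
  push_cast
  field_simp

/-- `h_η'(−η + iv) = −(π/2η)² sech²(πv/2η)`. [folklore] -/
theorem fordCotDeriv_neg_eta_add (hη : η ≠ 0) (v : ℝ) :
    fordCotDeriv η (-η + v * I) = -((((π / (2 * η)) ^ 2 / Real.cosh (π / (2 * η) * v) ^ 2 : ℝ) : ℂ)) := by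
  set ν : ℝ := π / (2 * η) with hν
  have harg : ((ν : ℝ) : ℂ) * (-η + v * I) = ((ν * v : ℝ) : ℂ) * I - π / 2 := by
    rw [mul_add, mul_neg, nu_mul_eta hη]; push_cast; ring
  rw [fordCotDeriv, harg, Complex.sin_sub_pi_div_two, Complex.cos_mul_I, ← ofReal_cosh]
  have hη' : (η : ℂ) ≠ 0 := by exact_mod_cast hη
  have hc : (Real.cosh (ν * v) : ℂ) ≠ 0 := by exact_mod_cast (Real.cosh_pos _).ne'
  simp only [hν] at hc ⊢
  push_cast
  field_simp

/-- `‖sin(x + iy)‖² = sin² x + sinh² y ≥ sinh² y`. [folklore] -/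
theorem sinh_sq_le_normSq_sin (x y : ℝ) : Real.sinh y ^ 2 ≤ ‖Complex.sin (x + y * I)‖ ^ 2 := by
  have hs : Complex.sin (x + y * I) =
      ((Real.sin x * Real.cosh y : ℝ) : ℂ) + ((Real.cos x * Real.sinh y : ℝ) : ℂ) * I := by
    rw [Complex.sin_add_mul_I]; push_cast; ring
  rw [hs, Complex.sq_norm, Complex.normSq_add_mul_I]
  have h1 := Real.sin_sq_add_cos_sq x
  have h2 := Real.cosh_sq y  -- cosh² = sinh² + 1
  nlinarith [sq_nonneg (Real.sin x * Real.sinh y), sq_nonneg (Real.sin x), sq_nonneg (Real.sinh y)]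

/-- On a horizontal line at distance `V` from the real axis the kernel derivative is exponentially
small: `‖h_η'(u + iV)‖ ≤ (π/2η)²/sinh²(πV/2η)` (`V ≠ 0`). [folklore] -/
theorem norm_fordCotDeriv_le (hη : 0 < η) (u : ℝ) {V : ℝ} (hV : V ≠ 0) :
    ‖fordCotDeriv η (u + V * I)‖ ≤ (π / (2 * η)) ^ 2 / Real.sinh (π / (2 * η) * V) ^ 2 := by
  set ν : ℝ := π / (2 * η) with hν
  have hν0 : 0 < ν := by positivity
  have harg : ((ν : ℝ) : ℂ) * (u + V * I) = ((ν * u : ℝ) : ℂ) + ((ν * V : ℝ) : ℂ) * I := by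
    push_cast; ring
  have hsinh : 0 < Real.sinh (ν * V) ^ 2 := by
    have : Real.sinh (ν * V) ≠ 0 := by
      exact Real.sinh_ne_zero.mpr (mul_ne_zero hν0.ne' hV)
    positivity
  rw [fordCotDeriv, harg, norm_div, norm_neg, norm_pow, norm_pow, Complex.norm_real, Real.norm_eq_abs,
    abs_of_pos hν0]
  have hle := sinh_sq_le_normSq_sin (ν * u) (ν * V)
  exact div_le_div_of_nonneg_left (by positivity) hsinh hle

/-- The kernel is complex differentiable away from its poles: `z ↦ h_η(z − z₀)` has derivative
`h_η'(z − z₀)`. [folklore] -/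
theorem hasDerivAt_fordCot_sub {z z₀ : ℂ}
    (hz : Complex.sin (((π / (2 * η) : ℝ) : ℂ) * (z - z₀)) ≠ 0) :
    HasDerivAt (fun w ↦ fordCot η (w - z₀)) (fordCotDeriv η (z - z₀)) z := by
  have h := (hasDerivAt_fordCot hz).comp z ((hasDerivAt_id z).sub_const z₀)
  rw [mul_one] at h
  exact h

/-- `z ↦ h_η(z − z₀)` is analytic away from the poles. [folklore] -/
theorem analyticAt_fordCot_sub {z z₀ : ℂ}
    (hz : Complex.sin (((π / (2 * η) : ℝ) : ℂ) * (z - z₀)) ≠ 0) :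
    AnalyticAt ℂ (fun w ↦ fordCot η (w - z₀)) z := by
  set U : Set ℂ := {w | Complex.sin (((π / (2 * η) : ℝ) : ℂ) * (w - z₀)) ≠ 0} with hU
  have hUo : IsOpen U := isOpen_ne_fun (by fun_prop) continuous_const
  have hd : DifferentiableOn ℂ (fun w ↦ fordCot η (w - z₀)) U := fun w hw ↦
    (hasDerivAt_fordCot_sub hw).differentiableAt.differentiableWithinAt
  exact hd.analyticAt (hUo.mem_nhds hz)

/-! ### The pole of the kernel at `0` -/

/-- `S_η(w) = sin(πw/2η)/w`, extended by its limit `π/2η` at `w = 0` (an entire function).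
[folklore] -/
def sinQuot (η : ℝ) : ℂ → ℂ :=
  dslope (fun w : ℂ ↦ Complex.sin (((π / (2 * η) : ℝ) : ℂ) * w)) 0

/-- `S_η(0) = π/2η`. [folklore] -/
theorem sinQuot_zero : sinQuot η 0 = ((π / (2 * η) : ℝ) : ℂ) := by
  rw [sinQuot, dslope_same]
  have h1 : HasDerivAt (fun w : ℂ ↦ ((π / (2 * η) : ℝ) : ℂ) * w) ((π / (2 * η) : ℝ) : ℂ) 0 := by
    simpa using (hasDerivAt_id (0 : ℂ)).const_mul (((π / (2 * η) : ℝ) : ℂ))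
  have h : HasDerivAt (fun w : ℂ ↦ Complex.sin (((π / (2 * η) : ℝ) : ℂ) * w))
      (Complex.cos (((π / (2 * η) : ℝ) : ℂ) * 0) * ((π / (2 * η) : ℝ) : ℂ)) 0 :=
    (Complex.hasDerivAt_sin _).comp 0 h1
  rw [h.deriv]
  simp

/-- `w · S_η(w) = sin(πw/2η)`. [folklore] -/
theorem mul_sinQuot (w : ℂ) : w * sinQuot η w = Complex.sin (((π / (2 * η) : ℝ) : ℂ) * w) := by
  have h := sub_smul_dslope (fun w : ℂ ↦ Complex.sin (((π / (2 * η) : ℝ) : ℂ) * w)) 0 w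
  simp only [sub_zero, smul_eq_mul, mul_zero, Complex.sin_zero] at h
  rw [sinQuot, h]

/-- `S_η` is entire. [folklore] -/
theorem differentiable_sinQuot : Differentiable ℂ (sinQuot η) := by
  rw [← differentiableOn_univ, sinQuot, Complex.differentiableOn_dslope Filter.univ_mem]
  intro w _
  exact (((differentiableAt_id).const_mul _).csin).differentiableWithinAt

/-- The regular part of the kernel at its pole: `H_η(w) = (π/2η) cos(πw/2η)/S_η(w)`, analytic near
`0`, `H_η(0) = 1`, and `h_η(w) = H_η(w)/w` near `0` (so `h_η` has a simple pole with residue `1`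
at `0`). [folklore] -/
def fordCotReg (η : ℝ) (w : ℂ) : ℂ :=
  ((π / (2 * η) : ℝ) : ℂ) * Complex.cos (((π / (2 * η) : ℝ) : ℂ) * w) / sinQuot η w

/-- `H_η(0) = 1` (`η ≠ 0`). [folklore] -/
theorem fordCotReg_zero (hη : η ≠ 0) : fordCotReg η 0 = 1 := by
  have hν : ((π / (2 * η) : ℝ) : ℂ) ≠ 0 := by
    have : (π / (2 * η) : ℝ) ≠ 0 := div_ne_zero Real.pi_pos.ne' (mul_ne_zero two_ne_zero hη)
    exact_mod_cast this
  rw [fordCotReg, sinQuot_zero, mul_zero, Complex.cos_zero, mul_one, div_self hν]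

/-- `h_η(w) = H_η(w)/w` wherever `sin(πw/2η) ≠ 0`. [folklore] -/
theorem fordCot_eq_fordCotReg_div {w : ℂ} (hw : Complex.sin (((π / (2 * η) : ℝ) : ℂ) * w) ≠ 0) :
    fordCot η w = fordCotReg η w / w := by
  have hw0 : w ≠ 0 := by rintro rfl; simp at hw
  have hS : sinQuot η w ≠ 0 := by
    intro h; rw [← mul_sinQuot, h, mul_zero] at hw; exact hw rfl
  rw [fordCot, fordCotReg, Complex.cot_eq_cos_div_sin, ← mul_sinQuot]
  field_simp

/-- `H_η` is differentiable wherever `S_η ≠ 0`. [folklore] -/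
theorem differentiableAt_fordCotReg {w : ℂ} (hw : sinQuot η w ≠ 0) :
    DifferentiableAt ℂ (fordCotReg η) w := by
  unfold fordCotReg
  exact (((differentiableAt_id.const_mul _).ccos).const_mul _).div (differentiable_sinQuot w) hw

/-! ### The logarithmic derivative near a zero -/

/-- **Local structure of `f'/f` at a zero.** If `f` is analytic at `ρ` and not identically zero
near `ρ`, then `f'/f = ψ/(z − ρ)` on a punctured neighbourhood of `ρ` with `ψ` analytic at `ρ` and
`ψ(ρ) = m`, the multiplicity of `ρ` (`f = (z−ρ)^m g`, `ψ = m + (z−ρ)g'/g`). [folklore] -/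
theorem logDeriv_eq_div_sub_near {f : ℂ → ℂ} {ρ : ℂ} (hf : AnalyticAt ℂ f ρ)
    (hne : analyticOrderAt f ρ ≠ ⊤) :
    ∃ ψ : ℂ → ℂ, AnalyticAt ℂ ψ ρ ∧ ψ ρ = (analyticOrderNatAt f ρ : ℂ) ∧
      ∀ᶠ z in 𝓝 ρ, z ≠ ρ → deriv f z / f z = ψ z / (z - ρ) := by
  obtain ⟨g, hg_an, hg_ne, hfg⟩ := hf.analyticOrderAt_ne_top.mp hne
  set m : ℕ := analyticOrderNatAt f ρ with hm
  refine ⟨fun z ↦ (m : ℂ) + (z - ρ) * (deriv g z / g z), ?_, by simp, ?_⟩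
  · exact analyticAt_const.add ((analyticAt_id.sub analyticAt_const).mul
      (hg_an.deriv.div hg_an hg_ne))
  · filter_upwards [hfg.eventually_nhds, hg_an.continuousAt.eventually_ne hg_ne,
      hg_an.eventually_analyticAt] with z hz hgz hgaz hzρ
    have hzρ' : z - ρ ≠ 0 := sub_ne_zero.2 hzρ
    have hfz : f z = (z - ρ) ^ m * g z := by
      have := hz.self_of_nhds; simpa [smul_eq_mul] using this
    have hfz0 : f z ≠ 0 := by rw [hfz]; exact mul_ne_zero (pow_ne_zero _ hzρ') hgz
    have h1 : HasDerivAt (fun w : ℂ ↦ (w - ρ) ^ m) ((m : ℂ) * (z - ρ) ^ (m - 1) * 1) z :=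
      ((hasDerivAt_id z).sub_const ρ).pow m
    have h2 : HasDerivAt g (deriv g z) z := hgaz.differentiableAt.hasDerivAt
    have h3 := h1.mul h2
    have hev : f =ᶠ[𝓝 z] fun w ↦ (w - ρ) ^ m * g w :=
      hz.mono fun w hw ↦ by simpa [smul_eq_mul] using hw
    have hderiv : deriv f z = (m : ℂ) * (z - ρ) ^ (m - 1) * 1 * g z + (z - ρ) ^ m * deriv g z := by
      rw [hev.deriv_eq]; exact h3.deriv
    rw [div_eq_div_iff hfz0 hzρ', hderiv, hfz]
    rcases Nat.eq_zero_or_pos m with hm0 | hmpos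
    · rw [hm0]; push_cast; field_simp; ring
    · obtain ⟨k, hk⟩ := Nat.exists_eq_add_of_le hmpos
      rw [hk, Nat.add_sub_cancel_left, show 1 + k = k + 1 from add_comm 1 k, pow_succ]
      push_cast
      field_simp

/-! ### The residue step: `∮ (f'/f)(z) h_η(z − z₀) dz` -/

variable {a b c d : ℝ}

/-- Points of the closed rectangle lie within `b − a` of the abscissa of an interior point.
[folklore] -/
theorem abs_re_sub_lt_of_mem {z z₀ : ℂ} (hz : z ∈ Icc a b ×ℂ Icc c d) (hz₀ : z₀ ∈ Ioo a b ×ℂ Ioo c d)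
    (hba : b - a ≤ 2 * η) : |(z - z₀).re| < 2 * η := by
  rw [sub_re, abs_lt]
  rw [mem_reProdIm] at hz hz₀
  constructor <;> linarith [hz.1.1, hz.1.2, hz₀.1.1, hz₀.1.2]

/-- A zero of `f` in the closed rectangle lies in the open rectangle when `f ≠ 0` on the edges.
[folklore] -/
theorem mem_Ioo_of_zero {f : ℂ → ℂ} (h_bot : ∀ x ∈ Icc a b, f (x + c * I) ≠ 0)
    (h_top : ∀ x ∈ Icc a b, f (x + d * I) ≠ 0) (h_left : ∀ y ∈ Icc c d, f (a + y * I) ≠ 0)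
    (h_right : ∀ y ∈ Icc c d, f (b + y * I) ≠ 0) {z : ℂ} (hz : z ∈ Icc a b ×ℂ Icc c d)
    (h0 : f z = 0) : z ∈ Ioo a b ×ℂ Ioo c d := by
  obtain ⟨⟨hza, hzb⟩, ⟨hzc, hzd⟩⟩ := hz
  have hz_eq : z = (z.re : ℂ) + (z.im : ℂ) * I := (re_add_im z).symm
  rcases hza.eq_or_lt with h | hza'
  · exact absurd h0 (by rw [hz_eq, ← h]; exact h_left z.im ⟨hzc, hzd⟩)
  rcases hzb.eq_or_lt with h | hzb'
  · exact absurd h0 (by rw [hz_eq, h]; exact h_right z.im ⟨hzc, hzd⟩)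
  rcases hzc.eq_or_lt with h | hzc'
  · exact absurd h0 (by rw [hz_eq, ← h]; exact h_bot z.re ⟨hza, hzb⟩)
  rcases hzd.eq_or_lt with h | hzd'
  · exact absurd h0 (by rw [hz_eq, h]; exact h_top z.re ⟨hza, hzb⟩)
  exact ⟨⟨hza', hzb'⟩, ⟨hzc', hzd'⟩⟩

/-- **Residue theorem for `(f'/f)(z) · h_η(z − z₀)` on a rectangle of width `≤ 2η`.** For `f`
analytic on the closed rectangle `K = [a,b] × [c,d]`, non-zero on `∂K` and at the interior point
`z₀`: `∮_{∂K} (f'/f)(z) h_η(z − z₀) dz = 2πi [ (f'/f)(z₀) + Σ_{ρ ∈ K°, f(ρ)=0} m(ρ) h_η(ρ − z₀) ]`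
(the kernel has a simple pole with residue `1` at `z₀` and no other pole in `K`; at a zero `ρ` of
multiplicity `m` the residue of `(f'/f) h_η(· − z₀)` is `m h_η(ρ − z₀)`). This is display (2.2)
in the proof of Ford's Lemma 2.2. [cite: Ford2002Millennium, §2, proof of Lemma 2.2] -/
theorem rectBoundaryIntegral_logDeriv_mul_fordCot {f : ℂ → ℂ} {z₀ : ℂ} (hη : 0 < η)
    (hab : a < b) (hcd : c < d) (hba : b - a ≤ 2 * η) (hz₀ : z₀ ∈ Ioo a b ×ℂ Ioo c d)
    (hf : AnalyticOnNhd ℂ f (Icc a b ×ℂ Icc c d))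
    (h_bot : ∀ x ∈ Icc a b, f (x + c * I) ≠ 0) (h_top : ∀ x ∈ Icc a b, f (x + d * I) ≠ 0)
    (h_left : ∀ y ∈ Icc c d, f (a + y * I) ≠ 0) (h_right : ∀ y ∈ Icc c d, f (b + y * I) ≠ 0)
    (h0 : f z₀ ≠ 0) :
    rectBoundaryIntegral (fun z ↦ deriv f z / f z * fordCot η (z - z₀)) a b c d =
      2 * π * I * (deriv f z₀ / f z₀ +
        ∑ᶠ ρ ∈ {ρ : ℂ | f ρ = 0 ∧ ρ ∈ Ioo a b ×ℂ Ioo c d},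
          ((meromorphicOrderAt f ρ).untop₀ : ℂ) * fordCot η (ρ - z₀)) := by
  classical
  set ν : ℂ := ((π / (2 * η) : ℝ) : ℂ) with hν
  have hz₀K : z₀ ∈ Icc a b ×ℂ Icc c d := ⟨Ioo_subset_Icc_self hz₀.1, Ioo_subset_Icc_self hz₀.2⟩
  have hfin := finite_zeros_reProdIm hab.le hcd.le hf hz₀K h0
  set Z : Finset ℂ := hfin.toFinset with hZ
  have hmemZ : ∀ ρ, ρ ∈ Z ↔ f ρ = 0 ∧ ρ ∈ Ioo a b ×ℂ Ioo c d := fun ρ ↦ by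
    rw [hZ, Set.Finite.mem_toFinset]; rfl
  have hz₀Z : z₀ ∉ Z := fun h ↦ h0 ((hmemZ z₀).1 h).1
  -- the zeros of `f` in `K` are the points of `Z`
  have hzero : ∀ z ∈ Icc a b ×ℂ Icc c d, f z = 0 → z ∈ Z := fun z hz hfz ↦
    (hmemZ z).2 ⟨hfz, mem_Ioo_of_zero h_bot h_top h_left h_right hz hfz⟩
  -- no pole of the kernel in `K` other than `z₀`
  have hsin : ∀ z ∈ Icc a b ×ℂ Icc c d, z ≠ z₀ → Complex.sin (ν * (z - z₀)) ≠ 0 := fun z hz hne ↦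
    sin_ne_zero_of_abs_re_lt hη (sub_ne_zero.2 hne) (abs_re_sub_lt_of_mem hz hz₀ hba)
  -- the residues
  set r : ℂ → ℂ := fun p ↦ if p = z₀ then deriv f z₀ / f z₀
    else ((meromorphicOrderAt f p).untop₀ : ℂ) * fordCot η (p - z₀) with hr
  -- the open set
  set U : Set ℂ := ({z | AnalyticAt ℂ f z ∧ f z ≠ 0} ∪ Ioo a b ×ℂ Ioo c d) ∩
    {z | |(z - z₀).re| < 2 * η} with hU_def
  have hU1 : IsOpen {z : ℂ | AnalyticAt ℂ f z ∧ f z ≠ 0} := by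
    rw [isOpen_iff_mem_nhds]
    rintro z ⟨hza, hz0⟩
    exact (hza.eventually_analyticAt.and (hza.continuousAt.eventually_ne hz0))
  have hU : IsOpen U := by
    refine (hU1.union (isOpen_Ioo.reProdIm isOpen_Ioo)).inter ?_
    exact isOpen_lt (continuous_abs.comp (continuous_re.comp (continuous_id.sub continuous_const)))
      continuous_const
  have hKU : Icc a b ×ℂ Icc c d ⊆ U := by
    intro z hz
    refine ⟨?_, abs_re_sub_lt_of_mem hz hz₀ hba⟩
    by_cases hfz : f z = 0
    · exact Or.inr (mem_Ioo_of_zero h_bot h_top h_left h_right hz hfz)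
    · exact Or.inl ⟨hf z hz, hfz⟩
  have hS : ((insert z₀ Z : Finset ℂ) : Set ℂ) ⊆ Ioo a b ×ℂ Ioo c d := by
    intro z hz
    rw [Finset.coe_insert, Set.mem_insert_iff] at hz
    rcases hz with rfl | hz
    · exact hz₀
    · exact ((hmemZ z).1 hz).2
  -- differentiability off the poles
  have hF : DifferentiableOn ℂ (fun z ↦ deriv f z / f z * fordCot η (z - z₀))
      (U \ ↑(insert z₀ Z)) := by
    rintro z ⟨⟨hzU, hzre⟩, hzS⟩
    rw [Finset.coe_insert, Set.mem_insert_iff, not_or] at hzS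
    have hfa : AnalyticAt ℂ f z ∧ f z ≠ 0 := by
      rcases hzU with h | h
      · exact h
      · have hzK : z ∈ Icc a b ×ℂ Icc c d := ⟨Ioo_subset_Icc_self h.1, Ioo_subset_Icc_self h.2⟩
        exact ⟨hf z hzK, fun hfz ↦ hzS.2 (hzero z hzK hfz)⟩
    have hsz : Complex.sin (ν * (z - z₀)) ≠ 0 :=
      sin_ne_zero_of_abs_re_lt hη (sub_ne_zero.2 hzS.1) hzre
    exact (((hfa.1.deriv.differentiableAt).div hfa.1.differentiableAt hfa.2).mul
      (hasDerivAt_fordCot_sub hsz).differentiableAt).differentiableWithinAt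
  -- the pole structure
  have hpole : ∀ p ∈ insert z₀ Z, ∃ φ : ℂ → ℂ, ∃ V ∈ 𝓝 p, DifferentiableOn ℂ φ V ∧ φ p = r p ∧
      ∀ z ∈ V, z ≠ p → deriv f z / f z * fordCot η (z - z₀) = φ z / (z - p) := by
    intro p hp
    rw [Finset.mem_insert] at hp
    rcases hp with rfl | hpZ
    · -- the pole of the kernel
      refine ⟨fun z ↦ deriv f z / f z * fordCotReg η (z - p),
        {z | AnalyticAt ℂ f z ∧ f z ≠ 0} ∩ {z | sinQuot η (z - p) ≠ 0}, ?_, ?_, ?_, ?_⟩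
      · refine Filter.inter_mem (hU1.mem_nhds ⟨hf p hz₀K, h0⟩) ?_
        have hc : ContinuousAt (fun z ↦ sinQuot η (z - p)) p :=
          (differentiable_sinQuot (η := η)).continuous.continuousAt.comp
            (continuousAt_id.sub continuousAt_const)
        refine hc.eventually_ne ?_
        rw [sub_self, sinQuot_zero]
        exact_mod_cast (div_pos Real.pi_pos (by positivity)).ne'
      · rintro z ⟨⟨hza, hz0⟩, hzS⟩
        refine ((((hza.deriv.differentiableAt).div hza.differentiableAt hz0).mul ?_)).differentiableWithinAt
        exact (differentiableAt_fordCotReg hzS).comp z (differentiableAt_id.sub_const p)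
      · simp [hr, fordCotReg_zero hη.ne']
      · rintro z ⟨-, hzS⟩ hzp
        have hsz : Complex.sin (ν * (z - p)) ≠ 0 := by
          rw [← mul_sinQuot]; exact mul_ne_zero (sub_ne_zero.2 hzp) hzS
        rw [fordCot_eq_fordCotReg_div hsz, mul_div_assoc]
    · -- a zero of `f`
      obtain ⟨hp0, hpR⟩ := (hmemZ p).1 hpZ
      have hpK : p ∈ Icc a b ×ℂ Icc c d := ⟨Ioo_subset_Icc_self hpR.1, Ioo_subset_Icc_self hpR.2⟩
      have hpz₀ : p ≠ z₀ := fun h ↦ h0 (h ▸ hp0)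
      have hne_top : analyticOrderAt f p ≠ ⊤ :=
        analyticOrderAt_ne_top_of_reProdIm hab.le hcd.le hf hz₀K h0 hpK
      obtain ⟨ψ, hψ_an, hψp, hψ⟩ := logDeriv_eq_div_sub_near (hf p hpK) hne_top
      have hsinp : Complex.sin (ν * (p - z₀)) ≠ 0 := hsin p hpK hpz₀
      refine ⟨fun z ↦ ψ z * fordCot η (z - z₀),
        {z | z ≠ p → deriv f z / f z = ψ z / (z - p)} ∩ {z | AnalyticAt ℂ ψ z} ∩
          {z | Complex.sin (ν * (z - z₀)) ≠ 0}, ?_, ?_, ?_, ?_⟩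
      · refine Filter.inter_mem (Filter.inter_mem hψ hψ_an.eventually_analyticAt) ?_
        exact (isOpen_ne_fun (by fun_prop) continuous_const).mem_nhds hsinp
      · rintro z ⟨⟨-, hza⟩, hzs⟩
        exact (hza.differentiableAt.mul (hasDerivAt_fordCot_sub hzs).differentiableAt).differentiableWithinAt
      · have horder : ((meromorphicOrderAt f p).untop₀ : ℂ) = (analyticOrderNatAt f p : ℂ) := by
          rw [(hf p hpK).meromorphicOrderAt_eq, ← Nat.cast_analyticOrderNatAt hne_top]
          simp
        simp only [hr, if_neg hpz₀, horder, hψp]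
      · rintro z ⟨⟨hz1, -⟩, -⟩ hzp
        rw [hz1 hzp]
        ring
  have key := rectBoundaryIntegral_eq_sum_of_simplePoles hab hcd (insert z₀ Z) _ r U hU hKU hS hF hpole
  rw [key, Finset.sum_insert hz₀Z, finsum_mem_eq_finite_toFinset_sum _ hfin]
  congr 1
  have hr0 : r z₀ = deriv f z₀ / f z₀ := by simp [hr]
  rw [hr0]
  congr 1
  refine Finset.sum_congr rfl fun ρ hρ ↦ ?_
  have hρz₀ : ρ ≠ z₀ := fun h ↦ hz₀Z (h ▸ hρ)
  simp [hr, if_neg hρz₀]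

/-! ### Sign of the kernel -/

/-- The kernel is odd: `h_η(−w) = −h_η(w)`. [folklore] -/
theorem fordCot_neg (η : ℝ) (w : ℂ) : fordCot η (-w) = -fordCot η w := by
  simp only [fordCot, mul_neg, Complex.cot_eq_cos_div_sin, Complex.cos_neg, Complex.sin_neg, div_neg]

/-- `Re cot(x + iy) = sin x cos x / |sin(x + iy)|²`. [folklore] -/
theorem re_cot_add_mul_I (x y : ℝ) :
    (Complex.cot (x + y * I)).re = Real.sin x * Real.cos x / Complex.normSq (Complex.sin (x + y * I)) := by
  rw [Complex.cot_eq_cos_div_sin, Complex.div_re]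
  have hs : Complex.sin (x + y * I) =
      ((Real.sin x * Real.cosh y : ℝ) : ℂ) + ((Real.cos x * Real.sinh y : ℝ) : ℂ) * I := by
    rw [Complex.sin_add_mul_I]; push_cast; ring
  have hc : Complex.cos (x + y * I) =
      ((Real.cos x * Real.cosh y : ℝ) : ℂ) + ((-(Real.sin x * Real.sinh y) : ℝ) : ℂ) * I := by
    rw [Complex.cos_add_mul_I]; push_cast; ring
  have hre : ∀ u v : ℝ, (((u : ℝ) : ℂ) + ((v : ℝ) : ℂ) * I).re = u := fun u v ↦ by simp
  have him : ∀ u v : ℝ, (((u : ℝ) : ℂ) + ((v : ℝ) : ℂ) * I).im = v := fun u v ↦ by simp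
  rw [hs, hc, hre, hre, him, him, ← hs]
  have hid := Real.cosh_sq y
  rw [← add_div]
  congr 1
  linear_combination Real.sin x * Real.cos x * hid

/-- **Sign of the kernel to the left of the pole.** For `−η ≤ Re w ≤ 0` (`η > 0`):
`Re h_η(w) ≤ 0` (at the poles Lean's `cot` is `0`). With `w = ρ − z₀` this is Ford's remark that
the zeros with `Re ρ ≤ Re z₀` enter the detector with a non-positive sign, so that any of them may
be omitted from an upper bound for `−Re (f'/f)(z₀)`. [cite: Ford2002Millennium, proof of Lemma 4.1] -/
theorem re_fordCot_nonpos (hη : 0 < η) {w : ℂ} (h1 : -η ≤ w.re) (h2 : w.re ≤ 0) :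
    (fordCot η w).re ≤ 0 := by
  set ν : ℝ := π / (2 * η) with hν
  have hν0 : 0 < ν := by positivity
  have hw : ((ν : ℝ) : ℂ) * w = ((ν * w.re : ℝ) : ℂ) + ((ν * w.im : ℝ) : ℂ) * I := by
    conv_lhs => rw [← re_add_im w]
    push_cast; ring
  rw [fordCot, ← hν, hw, re_ofReal_mul, re_cot_add_mul_I]
  refine mul_nonpos_of_nonneg_of_nonpos hν0.le (div_nonpos_of_nonpos_of_nonneg ?_ (Complex.normSq_nonneg _))
  have hx1 : -(π / 2) ≤ ν * w.re := by
    have : ν * (-η) ≤ ν * w.re := mul_le_mul_of_nonneg_left h1 hν0.le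
    have e : ν * (-η) = -(π / 2) := by rw [hν]; field_simp
    linarith
  have hx2 : ν * w.re ≤ 0 := mul_nonpos_of_nonneg_of_nonpos hν0.le h2
  exact mul_nonpos_of_nonpos_of_nonneg
    (Real.sin_nonpos_of_nonpos_of_neg_pi_le hx2 (by linarith [Real.pi_pos]))
    (Real.cos_nonneg_of_mem_Icc ⟨by linarith, by linarith [Real.pi_pos]⟩)

/-- On the vertical line through the pole the kernel is purely imaginary: `Re h_η(iy) = 0`.
(For `ζ` and `z₀ = 1 + it` this is why the pole of `ζ` at `1` contributes nothing to the detector.)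
[folklore] -/
theorem re_fordCot_of_re_eq_zero (η : ℝ) {w : ℂ} (hw : w.re = 0) : (fordCot η w).re = 0 := by
  have hw' : ((π / (2 * η) : ℝ) : ℂ) * w = ((0 : ℝ) : ℂ) + ((π / (2 * η) * w.im : ℝ) : ℂ) * I := by
    conv_lhs => rw [← re_add_im w, hw]
    push_cast; ring
  rw [fordCot, hw', re_ofReal_mul, re_cot_add_mul_I, Real.sin_zero, zero_mul, zero_div, mul_zero]

/-! ### Integration by parts along the edges against an analytic weight -/

/-- **Integration by parts on a horizontal edge** against the primitive from the left end point:
for `F` continuous and `g` analytic at every point of `[a,b] × {y}`,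
`∫_a^b F(x+yi) g(x+yi) dx = (∫_a^b F) g(b+yi) − ∫_a^b (∫_a^x F(u+yi) du) g'(x+yi) dx`. [folklore] -/
theorem integral_mul_eq_sub_horizontal {F g : ℂ → ℂ} (y : ℝ) (hab : a ≤ b)
    (hF : ∀ x ∈ Icc a b, ContinuousAt F (x + y * I))
    (hg : ∀ x ∈ Icc a b, AnalyticAt ℂ g (x + y * I)) :
    ∫ x : ℝ in a..b, F (x + y * I) * g (x + y * I) =
      (∫ x : ℝ in a..b, F (x + y * I)) * g (b + y * I) -
        ∫ x : ℝ in a..b, (∫ u : ℝ in a..x, F (u + y * I)) * deriv g (x + y * I) := by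
  obtain ⟨hΛc, hΛd⟩ := hasDerivAt_primitive_horizontal y hab ⟨le_rfl, hab⟩ hF
  have hint : IntervalIntegrable (fun u : ℝ ↦ F (u + y * I)) volume a b :=
    intervalIntegrable_of_continuousAt_horizontal y hab hF
  have hint' : IntervalIntegrable (fun u : ℝ ↦ deriv g (u + y * I)) volume a b :=
    intervalIntegrable_of_continuousAt_horizontal y hab fun x hx ↦ (hg x hx).deriv.continuousAt
  have hu : ∀ x ∈ Ioo (min a b) (max a b),
      HasDerivAt (fun x : ℝ ↦ g (x + y * I)) (deriv g (x + y * I)) x := by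
    intro x hx
    rw [min_eq_left hab, max_eq_right hab] at hx
    have h1 : HasDerivAt (fun x : ℝ ↦ (x : ℂ) + y * I) 1 x := by
      simpa using ((hasDerivAt_id' x).ofReal_comp).add_const ((y : ℂ) * I)
    have h2 : HasDerivAt (fun x : ℝ ↦ g (x + y * I)) (deriv g (x + y * I) * 1) x :=
      HasDerivAt.comp x ((hg x (Ioo_subset_Icc_self hx)).differentiableAt.hasDerivAt) h1
    simpa using h2
  have hv : ∀ x ∈ Ioo (min a b) (max a b),
      HasDerivAt (fun x : ℝ ↦ ∫ u : ℝ in a..x, F (u + y * I)) (F (x + y * I)) x := by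
    intro x hx
    rw [min_eq_left hab, max_eq_right hab] at hx
    exact hΛd x hx
  have hgc : ContinuousOn (fun x : ℝ ↦ g (x + y * I)) (uIcc a b) := by
    intro x hx
    rw [uIcc_of_le hab] at hx
    exact ((hg x hx).continuousAt.comp (f := fun t : ℝ ↦ (t : ℂ) + y * I)
      (by fun_prop)).continuousWithinAt
  have hparts := integral_mul_deriv_eq_deriv_mul_of_hasDerivAt
    (u := fun x : ℝ ↦ g (x + y * I)) (v := fun x : ℝ ↦ ∫ u : ℝ in a..x, F (u + y * I))
    (u' := fun x : ℝ ↦ deriv g (x + y * I)) (v' := fun x : ℝ ↦ F (x + y * I))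
    hgc (by rwa [uIcc_of_le hab]) hu hv hint' hint
  rw [intervalIntegral.integral_same, mul_zero, sub_zero] at hparts
  calc ∫ x : ℝ in a..b, F (x + y * I) * g (x + y * I)
      = ∫ x : ℝ in a..b, g (x + y * I) * F (x + y * I) := by
        congr 1; ext x; ring
    _ = g (b + y * I) * (∫ x : ℝ in a..b, F (x + y * I)) -
          ∫ x : ℝ in a..b, deriv g (x + y * I) * ∫ u : ℝ in a..x, F (u + y * I) := hparts
    _ = _ := by
        rw [mul_comm]
        congr 1
        congr 1; ext x; ring

/-- **Integration by parts on a vertical edge** against the primitive from the lower end point: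
for `F` continuous and `g` analytic at every point of `{x} × [c,d]`,
`∫_c^d F(x+yi) g(x+yi) dy = (∫_c^d F) g(x+di) − i ∫_c^d (∫_c^y F(x+ui) du) g'(x+yi) dy`.
[folklore] -/
theorem integral_mul_eq_sub_vertical {F g : ℂ → ℂ} (x : ℝ) (hcd : c ≤ d)
    (hF : ∀ y ∈ Icc c d, ContinuousAt F (x + y * I))
    (hg : ∀ y ∈ Icc c d, AnalyticAt ℂ g (x + y * I)) :
    ∫ y : ℝ in c..d, F (x + y * I) * g (x + y * I) =
      (∫ y : ℝ in c..d, F (x + y * I)) * g (x + d * I) -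
        I * ∫ y : ℝ in c..d, (∫ u : ℝ in c..y, F (x + u * I)) * deriv g (x + y * I) := by
  obtain ⟨hΛc, hΛd⟩ := hasDerivAt_primitive_vertical x hcd ⟨le_rfl, hcd⟩ hF
  have hint : IntervalIntegrable (fun u : ℝ ↦ F (x + u * I)) volume c d :=
    intervalIntegrable_of_continuousAt_vertical x hcd hF
  have hint' : IntervalIntegrable (fun u : ℝ ↦ deriv g (x + u * I) * I) volume c d :=
    (intervalIntegrable_of_continuousAt_vertical x hcd
      fun y hy ↦ (hg y hy).deriv.continuousAt).mul_const I
  have hu : ∀ y ∈ Ioo (min c d) (max c d),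
      HasDerivAt (fun y : ℝ ↦ g (x + y * I)) (deriv g (x + y * I) * I) y := by
    intro y hy
    rw [min_eq_left hcd, max_eq_right hcd] at hy
    have h1 : HasDerivAt (fun y : ℝ ↦ (x : ℂ) + y * I) (1 * I) y := by
      simpa using (((hasDerivAt_id' y).ofReal_comp).mul_const I).const_add (x : ℂ)
    have h2 : HasDerivAt (fun y : ℝ ↦ g (x + y * I)) (deriv g (x + y * I) * (1 * I)) y :=
      HasDerivAt.comp y ((hg y (Ioo_subset_Icc_self hy)).differentiableAt.hasDerivAt) h1
    simpa using h2
  have hv : ∀ y ∈ Ioo (min c d) (max c d),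
      HasDerivAt (fun y : ℝ ↦ ∫ u : ℝ in c..y, F (x + u * I)) (F (x + y * I)) y := by
    intro y hy
    rw [min_eq_left hcd, max_eq_right hcd] at hy
    exact hΛd y hy
  have hgc : ContinuousOn (fun y : ℝ ↦ g (x + y * I)) (uIcc c d) := by
    intro y hy
    rw [uIcc_of_le hcd] at hy
    exact ((hg y hy).continuousAt.comp (f := fun t : ℝ ↦ (x : ℂ) + t * I)
      (by fun_prop)).continuousWithinAt
  have hparts := integral_mul_deriv_eq_deriv_mul_of_hasDerivAt
    (u := fun y : ℝ ↦ g (x + y * I)) (v := fun y : ℝ ↦ ∫ u : ℝ in c..y, F (x + u * I))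
    (u' := fun y : ℝ ↦ deriv g (x + y * I) * I) (v' := fun y : ℝ ↦ F (x + y * I))
    hgc (by rwa [uIcc_of_le hcd]) hu hv hint' hint
  rw [intervalIntegral.integral_same, mul_zero, sub_zero] at hparts
  calc ∫ y : ℝ in c..d, F (x + y * I) * g (x + y * I)
      = ∫ y : ℝ in c..d, g (x + y * I) * F (x + y * I) := by
        congr 1; ext y; ring
    _ = g (x + d * I) * (∫ y : ℝ in c..d, F (x + y * I)) -
          ∫ y : ℝ in c..d, deriv g (x + y * I) * I * ∫ u : ℝ in c..y, F (x + u * I) := hparts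
    _ = _ := by
        rw [mul_comm, ← intervalIntegral.integral_const_mul]
        congr 1
        congr 1; ext y; ring

/-! ### The kernel weight `sech²` on the vertical edges -/

/-- `d/dy [ν tanh(ν(y − y₀))] = ν²/cosh²(ν(y − y₀))`. [folklore] -/
theorem hasDerivAt_nu_tanh (ν y₀ y : ℝ) :
    HasDerivAt (fun y : ℝ ↦ ν * Real.tanh (ν * (y - y₀))) (ν ^ 2 / Real.cosh (ν * (y - y₀)) ^ 2) y := by
  have hc : Real.cosh (ν * (y - y₀)) ≠ 0 := (Real.cosh_pos _).ne'
  have h1 : HasDerivAt (fun y : ℝ ↦ ν * (y - y₀)) ν y := by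
    simpa using ((hasDerivAt_id y).sub_const y₀).const_mul ν
  have hs : HasDerivAt (fun y : ℝ ↦ Real.sinh (ν * (y - y₀))) (Real.cosh (ν * (y - y₀)) * ν) y :=
    (Real.hasDerivAt_sinh _).comp y h1
  have hco : HasDerivAt (fun y : ℝ ↦ Real.cosh (ν * (y - y₀))) (Real.sinh (ν * (y - y₀)) * ν) y :=
    (Real.hasDerivAt_cosh _).comp y h1
  have ht := (hs.div hco hc).const_mul ν
  have ht' : HasDerivAt (fun y : ℝ ↦ ν * Real.tanh (ν * (y - y₀)))
      (ν * ((Real.cosh (ν * (y - y₀)) * ν * Real.cosh (ν * (y - y₀)) -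
        Real.sinh (ν * (y - y₀)) * (Real.sinh (ν * (y - y₀)) * ν)) / Real.cosh (ν * (y - y₀)) ^ 2)) y := by
    refine ht.congr_of_eventuallyEq (Eventually.of_forall fun y ↦ ?_)
    simp [Real.tanh_eq_sinh_div_cosh]
  refine ht'.congr_deriv ?_
  have hid := Real.cosh_sq (ν * (y - y₀))
  field_simp
  linear_combination ν ^ 2 * hid

/-- `∫_c^d ν² sech²(ν(y − y₀)) dy = ν tanh(ν(d − y₀)) − ν tanh(ν(c − y₀))`. [folklore] -/
theorem integral_nu_sq_div_cosh_sq (ν y₀ c d : ℝ) :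
    ∫ y : ℝ in c..d, ν ^ 2 / Real.cosh (ν * (y - y₀)) ^ 2 =
      ν * Real.tanh (ν * (d - y₀)) - ν * Real.tanh (ν * (c - y₀)) := by
  refine integral_eq_sub_of_hasDerivAt (fun y _ ↦ hasDerivAt_nu_tanh ν y₀ y) ?_
  exact (continuous_const.div (by fun_prop)
    (fun y ↦ pow_ne_zero _ (Real.cosh_pos _).ne')).intervalIntegrable _ _

/-! ### Ford's Lemma 2.2 on a finite rectangle -/

/-- The horizontal-edge term of the finite form of Ford's zero detector at height `y`:
`H(y) = ∫_a^b Λ_y(x) h_η'(x + iy − z₀) dx`, `Λ_y(x) = ∫_a^x (f'/f)(u + iy) du` (the branch of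
`log f` along the edge vanishing at the left corner). It tends to `0` exponentially as the edge
recedes from `z₀` (`norm_fordHorizontalTerm_le`). [cite: Ford2002Millennium, §2, proof of Lemma 2.2] -/
def fordHorizontalTerm (f : ℂ → ℂ) (η : ℝ) (z₀ : ℂ) (a b y : ℝ) : ℂ :=
  ∫ x : ℝ in a..b, (∫ u : ℝ in a..x, deriv f (u + y * I) / f (u + y * I)) *
    fordCotDeriv η (x + y * I - z₀)

/-- **Bound for the horizontal-edge term.** If `‖(f'/f)(x + iy)‖ ≤ M` on `[a,b]` (with `f'/f`
continuous there) and the edge is at distance `|y − Im z₀| ≠ 0` from `z₀`, then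
`‖H(y)‖ ≤ (b − a)² M (π/2η)² / sinh²(π(y − Im z₀)/2η)` — exponentially small in the distance, as
in Ford's `|h'(η ± iT)| ≪ η⁻² e^{−πT/(2η)}` step. [cite: Ford2002Millennium, §2, proof of Lemma 2.2] -/
theorem norm_fordHorizontalTerm_le {f : ℂ → ℂ} {z₀ : ℂ} {y M : ℝ} (hη : 0 < η) (hab : a ≤ b)
    (hF : ∀ x ∈ Icc a b, ContinuousAt (fun z ↦ deriv f z / f z) (x + y * I))
    (hM : ∀ x ∈ Icc a b, ‖deriv f (x + y * I) / f (x + y * I)‖ ≤ M) (hy : y ≠ z₀.im) :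
    ‖fordHorizontalTerm f η z₀ a b y‖ ≤
      (b - a) ^ 2 * M * ((π / (2 * η)) ^ 2 / Real.sinh (π / (2 * η) * (y - z₀.im)) ^ 2) := by
  set K : ℝ := (π / (2 * η)) ^ 2 / Real.sinh (π / (2 * η) * (y - z₀.im)) ^ 2 with hK
  have hM0 : 0 ≤ M := (norm_nonneg _).trans (hM a ⟨le_rfl, hab⟩)
  have hK0 : 0 ≤ K := by positivity
  have hint : IntervalIntegrable (fun u : ℝ ↦ deriv f (u + y * I) / f (u + y * I)) volume a b :=
    intervalIntegrable_of_continuousAt_horizontal y hab hF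
  -- the primitive is bounded by `(b - a) M`
  have hΛ : ∀ x ∈ Icc a b, ‖∫ u : ℝ in a..x, deriv f (u + y * I) / f (u + y * I)‖ ≤ (b - a) * M := by
    intro x hx
    have h1 : ‖∫ u : ℝ in a..x, deriv f (u + y * I) / f (u + y * I)‖ ≤ M * |x - a| := by
      refine intervalIntegral.norm_integral_le_of_norm_le_const fun u hu ↦ hM u ?_
      rw [uIoc_of_le hx.1] at hu
      exact ⟨hu.1.le, hu.2.trans hx.2⟩
    rw [abs_of_nonneg (by linarith [hx.1])] at h1
    nlinarith [hx.2, hx.1]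
  -- the kernel derivative is bounded by `K`
  have hker : ∀ x : ℝ, ‖fordCotDeriv η (x + y * I - z₀)‖ ≤ K := by
    intro x
    have e : (x : ℂ) + y * I - z₀ = ((x - z₀.re : ℝ) : ℂ) + ((y - z₀.im : ℝ) : ℂ) * I := by
      apply Complex.ext <;> simp
    rw [e]
    exact norm_fordCotDeriv_le hη _ (sub_ne_zero.2 hy)
  have h := intervalIntegral.norm_integral_le_of_norm_le_const (a := a) (b := b) (C := (b - a) * M * K)
    (f := fun x : ℝ ↦ (∫ u : ℝ in a..x, deriv f (u + y * I) / f (u + y * I)) *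
      fordCotDeriv η (x + y * I - z₀)) ?_
  · rw [abs_of_nonneg (by linarith)] at h
    calc ‖fordHorizontalTerm f η z₀ a b y‖ ≤ (b - a) * M * K * (b - a) := h
      _ = (b - a) ^ 2 * M * K := by ring
  · intro x hx
    rw [uIoc_of_le hab] at hx
    rw [norm_mul]
    exact mul_le_mul (hΛ x ⟨hx.1.le, hx.2⟩) (hker x) (norm_nonneg _) (by positivity)

/-- **Ford's zero detector on a rectangle** (Ford 2002, Lemma 2.2, before `T → ∞`), in
branch-free form. Let `f` be analytic at every point of the closed rectangle
`K = [x₀ − η, x₀ + η] × [c, d]` (`η > 0`, `c < y₀ < d`), non-zero on `∂K` and at `z₀ = x₀ + iy₀`,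
and let `h_η(z) = (π/2η) cot(πz/2η)`. Then
`−Re (f'/f)(z₀) = Σ_{ρ ∈ K°, f(ρ)=0} m(ρ) Re h_η(ρ − z₀)`
`  + (π/8η²) ∫_c^d [log|f(x₀ − η + iy)| − log|f(x₀ + η + iy)|] sech²(π(y − y₀)/2η) dy`
`  − (Im H(d) − Im H(c))/2π`,
with `m(ρ)` the multiplicity and `H(y) = ∫ Λ_y h_η'(· + iy − z₀)` the horizontal-edge terms
(`fordHorizontalTerm`; by `norm_fordHorizontalTerm_le` they are
`≪ max|f'/f| · η⁻² e^{−π|y − y₀|/η}`, so they disappear when the horizontal edges recede, which is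
how Ford states the lemma, with the integral over the whole lines `Re z = x₀ ± η`).
Proof: the residue theorem for `(f'/f) h_η(· − z₀)` (`rectBoundaryIntegral_logDeriv_mul_fordCot`),
integration by parts on the four edges against the edge primitives of `f'/f`, and imaginary
parts: on the vertical edges `h_η = −i(π/2η) tanh` and `h_η' = −(π/2η)² sech²` are the same on both
sides, `Re Λ`/`Im Λ` are differences of `log|f|` (`re_integral_logDeriv_horizontal`,
`im_integral_logDeriv_vertical`), and all corner terms cancel against `∫ sech²`.
[cite: Ford2002Millennium, Lemma 2.2] -/
theorem ford_zero_detector_rect {f : ℂ → ℂ} {x₀ y₀ c d : ℝ} (hη : 0 < η) (hc : c < y₀)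
    (hd : y₀ < d) (hf : AnalyticOnNhd ℂ f (Icc (x₀ - η) (x₀ + η) ×ℂ Icc c d))
    (h_bot : ∀ x ∈ Icc (x₀ - η) (x₀ + η), f (x + c * I) ≠ 0)
    (h_top : ∀ x ∈ Icc (x₀ - η) (x₀ + η), f (x + d * I) ≠ 0)
    (h_left : ∀ y ∈ Icc c d, f ((x₀ - η : ℝ) + y * I) ≠ 0)
    (h_right : ∀ y ∈ Icc c d, f ((x₀ + η : ℝ) + y * I) ≠ 0)
    (h0 : f (x₀ + y₀ * I) ≠ 0) :
    -(deriv f (x₀ + y₀ * I) / f (x₀ + y₀ * I)).re =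
      (∑ᶠ ρ ∈ {ρ : ℂ | f ρ = 0 ∧ ρ ∈ Ioo (x₀ - η) (x₀ + η) ×ℂ Ioo c d},
          ((meromorphicOrderAt f ρ).untop₀ : ℝ) * (fordCot η (ρ - (x₀ + y₀ * I))).re)
      + π / (8 * η ^ 2) * (∫ y : ℝ in c..d,
          (Real.log ‖f ((x₀ - η : ℝ) + y * I)‖ - Real.log ‖f ((x₀ + η : ℝ) + y * I)‖)
            / Real.cosh (π / (2 * η) * (y - y₀)) ^ 2)
      - 1 / (2 * π) * ((fordHorizontalTerm f η (x₀ + y₀ * I) (x₀ - η) (x₀ + η) d).im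
          - (fordHorizontalTerm f η (x₀ + y₀ * I) (x₀ - η) (x₀ + η) c).im) := by
  set a : ℝ := x₀ - η with ha
  set b : ℝ := x₀ + η with hb
  set z₀ : ℂ := (x₀ : ℂ) + y₀ * I with hz₀
  set ν : ℝ := π / (2 * η) with hν
  have hab : a < b := by rw [ha, hb]; linarith
  have hcd : c < d := hc.trans hd
  have hba : b - a ≤ 2 * η := by rw [ha, hb]; linarith
  have hz₀R : z₀ ∈ Ioo a b ×ℂ Ioo c d := by
    refine ⟨?_, ?_⟩ <;> simp [hz₀, ha, hb, hη, hc, hd]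
  -- analyticity and non-vanishing at the edge points
  have hA_bot : ∀ x ∈ Icc a b, AnalyticAt ℂ f (x + c * I) := fun x hx ↦
    hf _ ⟨by simpa using hx, by simpa using hcd.le⟩
  have hA_top : ∀ x ∈ Icc a b, AnalyticAt ℂ f (x + d * I) := fun x hx ↦
    hf _ ⟨by simpa using hx, by simpa using hcd.le⟩
  have hA_left : ∀ y ∈ Icc c d, AnalyticAt ℂ f (a + y * I) := fun y hy ↦
    hf _ ⟨by simpa using hab.le, by simpa using hy⟩
  have hA_right : ∀ y ∈ Icc c d, AnalyticAt ℂ f (b + y * I) := fun y hy ↦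
    hf _ ⟨by simpa using hab.le, by simpa using hy⟩
  set F : ℂ → ℂ := fun z ↦ deriv f z / f z with hFdef
  have hF_bot : ∀ x ∈ Icc a b, ContinuousAt F (x + c * I) := fun x hx ↦
    continuousAt_logDeriv (hA_bot x hx) (h_bot x hx)
  have hF_top : ∀ x ∈ Icc a b, ContinuousAt F (x + d * I) := fun x hx ↦
    continuousAt_logDeriv (hA_top x hx) (h_top x hx)
  have hF_left : ∀ y ∈ Icc c d, ContinuousAt F (a + y * I) := fun y hy ↦
    continuousAt_logDeriv (hA_left y hy) (h_left y hy)
  have hF_right : ∀ y ∈ Icc c d, ContinuousAt F (b + y * I) := fun y hy ↦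
    continuousAt_logDeriv (hA_right y hy) (h_right y hy)
  -- the kernel on the edges
  set g : ℂ → ℂ := fun z ↦ fordCot η (z - z₀) with hgdef
  have hsin_edge : ∀ z : ℂ, z ∈ Icc a b ×ℂ Icc c d → z ≠ z₀ →
      Complex.sin (((π / (2 * η) : ℝ) : ℂ) * (z - z₀)) ≠ 0 := fun z hz hne ↦
    sin_ne_zero_of_abs_re_lt hη (sub_ne_zero.2 hne) (abs_re_sub_lt_of_mem hz hz₀R hba)
  have hne_bot : ∀ x ∈ Icc a b, ((x : ℂ) + c * I) ≠ z₀ := fun x _ h ↦ by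
    have := congrArg Complex.im h; simp [hz₀] at this; linarith
  have hne_top : ∀ x ∈ Icc a b, ((x : ℂ) + d * I) ≠ z₀ := fun x _ h ↦ by
    have := congrArg Complex.im h; simp [hz₀] at this; linarith
  have hne_left : ∀ y ∈ Icc c d, ((a : ℂ) + y * I) ≠ z₀ := fun y _ h ↦ by
    have := congrArg Complex.re h; simp [hz₀, ha] at this; linarith
  have hne_right : ∀ y ∈ Icc c d, ((b : ℂ) + y * I) ≠ z₀ := fun y _ h ↦ by
    have := congrArg Complex.re h; simp [hz₀, hb] at this; linarith
  have hmem_bot : ∀ x ∈ Icc a b, ((x : ℂ) + c * I) ∈ Icc a b ×ℂ Icc c d := fun x hx ↦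
    ⟨by simpa using hx, by simpa using hcd.le⟩
  have hmem_top : ∀ x ∈ Icc a b, ((x : ℂ) + d * I) ∈ Icc a b ×ℂ Icc c d := fun x hx ↦
    ⟨by simpa using hx, by simpa using hcd.le⟩
  have hmem_left : ∀ y ∈ Icc c d, ((a : ℂ) + y * I) ∈ Icc a b ×ℂ Icc c d := fun y hy ↦
    ⟨by simpa using hab.le, by simpa using hy⟩
  have hmem_right : ∀ y ∈ Icc c d, ((b : ℂ) + y * I) ∈ Icc a b ×ℂ Icc c d := fun y hy ↦
    ⟨by simpa using hab.le, by simpa using hy⟩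
  have hg_bot : ∀ x ∈ Icc a b, AnalyticAt ℂ g (x + c * I) := fun x hx ↦
    analyticAt_fordCot_sub (hsin_edge _ (hmem_bot x hx) (hne_bot x hx))
  have hg_top : ∀ x ∈ Icc a b, AnalyticAt ℂ g (x + d * I) := fun x hx ↦
    analyticAt_fordCot_sub (hsin_edge _ (hmem_top x hx) (hne_top x hx))
  have hg_left : ∀ y ∈ Icc c d, AnalyticAt ℂ g (a + y * I) := fun y hy ↦
    analyticAt_fordCot_sub (hsin_edge _ (hmem_left y hy) (hne_left y hy))
  have hg_right : ∀ y ∈ Icc c d, AnalyticAt ℂ g (b + y * I) := fun y hy ↦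
    analyticAt_fordCot_sub (hsin_edge _ (hmem_right y hy) (hne_right y hy))
  have hg_deriv : ∀ z : ℂ, z ∈ Icc a b ×ℂ Icc c d → z ≠ z₀ → deriv g z = fordCotDeriv η (z - z₀) :=
    fun z hz hne ↦ (hasDerivAt_fordCot_sub (hsin_edge z hz hne)).deriv
  -- values of the kernel and its derivative on the vertical edges
  set θ : ℝ → ℝ := fun y ↦ ν * Real.tanh (ν * (y - y₀)) with hθ
  set k : ℝ → ℝ := fun y ↦ ν ^ 2 / Real.cosh (ν * (y - y₀)) ^ 2 with hk
  have hb_sub : ∀ y : ℝ, (b : ℂ) + y * I - z₀ = (η : ℂ) + ((y - y₀ : ℝ) : ℂ) * I := fun y ↦ by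
    simp only [hb, hz₀]; push_cast; ring
  have ha_sub : ∀ y : ℝ, (a : ℂ) + y * I - z₀ = -(η : ℂ) + ((y - y₀ : ℝ) : ℂ) * I := fun y ↦ by
    simp only [ha, hz₀]; push_cast; ring
  have hg_b : ∀ y : ℝ, g (b + y * I) = -((θ y : ℝ) : ℂ) * I := fun y ↦ by
    simp only [hgdef, hθ, hν]; rw [hb_sub, fordCot_eta_add hη.ne']
  have hg_a : ∀ y : ℝ, g (a + y * I) = -((θ y : ℝ) : ℂ) * I := fun y ↦ by
    simp only [hgdef, hθ, hν]; rw [ha_sub, fordCot_neg_eta_add hη.ne']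
  have hg'_b : ∀ y ∈ Icc c d, deriv g (b + y * I) = -((k y : ℝ) : ℂ) := fun y hy ↦ by
    rw [hg_deriv _ (hmem_right y hy) (hne_right y hy), hb_sub, fordCotDeriv_eta_add hη.ne']
  have hg'_a : ∀ y ∈ Icc c d, deriv g (a + y * I) = -((k y : ℝ) : ℂ) := fun y hy ↦ by
    rw [hg_deriv _ (hmem_left y hy) (hne_left y hy), ha_sub, fordCotDeriv_neg_eta_add hη.ne']
  -- the residue theorem with the kernel
  have hW := rectBoundaryIntegral_logDeriv_mul_fordCot hη hab hcd hba hz₀R hf h_bot h_top h_left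
    h_right h0
  rw [rectBoundaryIntegral] at hW
  -- integration by parts on the four edges
  have hBot := integral_mul_eq_sub_horizontal (F := F) (g := g) c hab.le hF_bot hg_bot
  have hTop := integral_mul_eq_sub_horizontal (F := F) (g := g) d hab.le hF_top hg_top
  have hRight := integral_mul_eq_sub_vertical (F := F) (g := g) b hcd.le hF_right hg_right
  have hLeft := integral_mul_eq_sub_vertical (F := F) (g := g) a hcd.le hF_left hg_left
  simp only [hFdef, hgdef] at hBot hTop hRight hLeft hW
  rw [hBot, hTop, hRight, hLeft] at hW
  -- rewrite the kernel values on the vertical edges and the horizontal-edge terms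
  have hHc : (∫ x : ℝ in a..b, (∫ u : ℝ in a..x, deriv f (u + c * I) / f (u + c * I)) *
      deriv (fun z ↦ fordCot η (z - z₀)) (x + c * I)) = fordHorizontalTerm f η z₀ a b c := by
    rw [fordHorizontalTerm]
    refine intervalIntegral.integral_congr fun x hx ↦ ?_
    rw [uIcc_of_le hab.le] at hx
    rw [hg_deriv _ (hmem_bot x hx) (hne_bot x hx)]
  have hHd : (∫ x : ℝ in a..b, (∫ u : ℝ in a..x, deriv f (u + d * I) / f (u + d * I)) *
      deriv (fun z ↦ fordCot η (z - z₀)) (x + d * I)) = fordHorizontalTerm f η z₀ a b d := by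
    rw [fordHorizontalTerm]
    refine intervalIntegral.integral_congr fun x hx ↦ ?_
    rw [uIcc_of_le hab.le] at hx
    rw [hg_deriv _ (hmem_top x hx) (hne_top x hx)]
  have hVb : (∫ y : ℝ in c..d, (∫ u : ℝ in c..y, deriv f (b + u * I) / f (b + u * I)) *
      deriv (fun z ↦ fordCot η (z - z₀)) (b + y * I)) =
        ∫ y : ℝ in c..d, (∫ u : ℝ in c..y, deriv f (b + u * I) / f (b + u * I)) * (-((k y : ℝ) : ℂ)) := by
    refine intervalIntegral.integral_congr fun y hy ↦ ?_
    rw [uIcc_of_le hcd.le] at hy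
    rw [hg'_b y hy]
  have hVa : (∫ y : ℝ in c..d, (∫ u : ℝ in c..y, deriv f (a + u * I) / f (a + u * I)) *
      deriv (fun z ↦ fordCot η (z - z₀)) (a + y * I)) =
        ∫ y : ℝ in c..d, (∫ u : ℝ in c..y, deriv f (a + u * I) / f (a + u * I)) * (-((k y : ℝ) : ℂ)) := by
    refine intervalIntegral.integral_congr fun y hy ↦ ?_
    rw [uIcc_of_le hcd.le] at hy
    rw [hg'_a y hy]
  simp only [hgdef] at hg_b hg_a
  rw [hHc, hHd, hVb, hVa, hg_b c, hg_b d, hg_a d] at hW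
  -- the real and imaginary parts of the edge integrals of `f'/f`
  have hPb : (∫ x : ℝ in a..b, deriv f (x + c * I) / f (x + c * I)).re =
      Real.log ‖f (b + c * I)‖ - Real.log ‖f (a + c * I)‖ :=
    re_integral_logDeriv_horizontal c hab.le hA_bot h_bot
  have hPt : (∫ x : ℝ in a..b, deriv f (x + d * I) / f (x + d * I)).re =
      Real.log ‖f (b + d * I)‖ - Real.log ‖f (a + d * I)‖ :=
    re_integral_logDeriv_horizontal d hab.le hA_top h_top
  have hR : (∫ y : ℝ in c..d, deriv f (b + y * I) / f (b + y * I)).im =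
      -(Real.log ‖f (b + d * I)‖ - Real.log ‖f (b + c * I)‖) :=
    im_integral_logDeriv_vertical b hcd.le hA_right h_right
  have hL : (∫ y : ℝ in c..d, deriv f (a + y * I) / f (a + y * I)).im =
      -(Real.log ‖f (a + d * I)‖ - Real.log ‖f (a + c * I)‖) :=
    im_integral_logDeriv_vertical a hcd.le hA_left h_left
  -- the kernel-weighted double integrals on the vertical edges
  have hk_cont : Continuous k :=
    continuous_const.div (by fun_prop) (fun y ↦ pow_ne_zero _ (Real.cosh_pos _).ne')
  have hJk : ∫ y : ℝ in c..d, k y = θ d - θ c := integral_nu_sq_div_cosh_sq ν y₀ c d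
  have hQv : ∀ x₁ : ℝ, (∀ y ∈ Icc c d, AnalyticAt ℂ f (x₁ + y * I)) →
      (∀ y ∈ Icc c d, f (x₁ + y * I) ≠ 0) →
      (∫ y : ℝ in c..d, (∫ u : ℝ in c..y, deriv f (x₁ + u * I) / f (x₁ + u * I)) *
          (-((k y : ℝ) : ℂ))).im =
        (∫ y : ℝ in c..d, k y * Real.log ‖f (x₁ + y * I)‖) - Real.log ‖f (x₁ + c * I)‖ * (θ d - θ c) := by
    intro x₁ hA h0
    obtain ⟨hΛc, -⟩ := hasDerivAt_primitive_vertical (F := F) x₁ hcd.le ⟨le_rfl, hcd.le⟩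
      (fun y hy ↦ continuousAt_logDeriv (hA y hy) (h0 y hy))
    simp only [hFdef] at hΛc
    have hint : IntervalIntegrable
        (fun y : ℝ ↦ (∫ u : ℝ in c..y, deriv f (x₁ + u * I) / f (x₁ + u * I)) * (-((k y : ℝ) : ℂ)))
        volume c d := by
      refine (hΛc.mul ?_).intervalIntegrable_of_Icc hcd.le
      exact (continuous_ofReal.comp hk_cont).neg.continuousOn
    have him := intervalIntegral_im hint
    simp only [RCLike.im_to_complex] at him
    rw [← him]
    have hcongr : EqOn
        (fun y : ℝ ↦ ((∫ u : ℝ in c..y, deriv f (x₁ + u * I) / f (x₁ + u * I)) * (-((k y : ℝ) : ℂ))).im)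
        (fun y : ℝ ↦ k y * Real.log ‖f (x₁ + y * I)‖ - Real.log ‖f (x₁ + c * I)‖ * k y) (uIcc c d) := by
      intro y hy
      rw [uIcc_of_le hcd.le] at hy
      simp only [mul_im, neg_re, ofReal_re, neg_im, ofReal_im, neg_zero, mul_zero]
      rw [im_integral_logDeriv_vertical x₁ hy.1 (fun u hu ↦ hA u ⟨hu.1, hu.2.trans hy.2⟩)
        (fun u hu ↦ h0 u ⟨hu.1, hu.2.trans hy.2⟩)]
      ring
    rw [intervalIntegral.integral_congr hcongr]
    have hlog : Continuous fun y : Icc c d ↦ Real.log ‖f (x₁ + (y : ℝ) * I)‖ := by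
      refine continuous_iff_continuousAt.2 fun y ↦ ?_
      have h1 : ContinuousAt (fun t : ℝ ↦ f (x₁ + t * I)) y :=
        (hA y y.2).continuousAt.comp (f := fun t : ℝ ↦ (x₁ : ℂ) + t * I) (by fun_prop)
      exact ((h1.norm).log (norm_ne_zero_iff.2 (h0 y y.2))).comp continuous_subtype_val.continuousAt
    have hlogI : IntervalIntegrable (fun y : ℝ ↦ k y * Real.log ‖f (x₁ + y * I)‖) volume c d := by
      refine ContinuousOn.intervalIntegrable_of_Icc hcd.le ?_
      rw [continuousOn_iff_continuous_restrict]
      exact (hk_cont.comp continuous_subtype_val).mul hlog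
    have hconstI : IntervalIntegrable (fun y : ℝ ↦ Real.log ‖f (x₁ + c * I)‖ * k y) volume c d :=
      (hk_cont.intervalIntegrable _ _).const_mul _
    rw [intervalIntegral.integral_sub hlogI hconstI, intervalIntegral.integral_const_mul, hJk]
  have hQr := hQv b hA_right h_right
  have hQl := hQv a hA_left h_left
  -- the zero sum is real up to taking real parts termwise
  have hfin := finite_zeros_reProdIm hab.le hcd.le hf
    (⟨Ioo_subset_Icc_self hz₀R.1, Ioo_subset_Icc_self hz₀R.2⟩ : z₀ ∈ Icc a b ×ℂ Icc c d) h0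
  have hZ : (∑ᶠ ρ ∈ {ρ : ℂ | f ρ = 0 ∧ ρ ∈ Ioo a b ×ℂ Ioo c d},
      ((meromorphicOrderAt f ρ).untop₀ : ℂ) * fordCot η (ρ - z₀)).re =
        ∑ᶠ ρ ∈ {ρ : ℂ | f ρ = 0 ∧ ρ ∈ Ioo a b ×ℂ Ioo c d},
          ((meromorphicOrderAt f ρ).untop₀ : ℝ) * (fordCot η (ρ - z₀)).re := by
    rw [finsum_mem_eq_finite_toFinset_sum _ hfin, finsum_mem_eq_finite_toFinset_sum _ hfin,
      Complex.re_sum]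
    refine Finset.sum_congr rfl fun ρ _ ↦ ?_
    simp [mul_re]
  -- the target integral in terms of `k`
  have hT : π / (8 * η ^ 2) * ∫ y : ℝ in c..d,
      (Real.log ‖f (a + y * I)‖ - Real.log ‖f (b + y * I)‖) / Real.cosh (ν * (y - y₀)) ^ 2 =
        1 / (2 * π) * ((∫ y : ℝ in c..d, k y * Real.log ‖f (a + y * I)‖) -
          ∫ y : ℝ in c..d, k y * Real.log ‖f (b + y * I)‖) := by
    have hla : Continuous fun y : Icc c d ↦ Real.log ‖f (a + (y : ℝ) * I)‖ := by
      refine continuous_iff_continuousAt.2 fun y ↦ ?_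
      have h1 : ContinuousAt (fun t : ℝ ↦ f (a + t * I)) y :=
        (hA_left y y.2).continuousAt.comp (f := fun t : ℝ ↦ (a : ℂ) + t * I) (by fun_prop)
      exact ((h1.norm).log (norm_ne_zero_iff.2 (h_left y y.2))).comp continuous_subtype_val.continuousAt
    have hlb : Continuous fun y : Icc c d ↦ Real.log ‖f (b + (y : ℝ) * I)‖ := by
      refine continuous_iff_continuousAt.2 fun y ↦ ?_
      have h1 : ContinuousAt (fun t : ℝ ↦ f (b + t * I)) y :=
        (hA_right y y.2).continuousAt.comp (f := fun t : ℝ ↦ (b : ℂ) + t * I) (by fun_prop)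
      exact ((h1.norm).log (norm_ne_zero_iff.2 (h_right y y.2))).comp continuous_subtype_val.continuousAt
    have hIa : IntervalIntegrable (fun y : ℝ ↦ k y * Real.log ‖f (a + y * I)‖) volume c d := by
      refine ContinuousOn.intervalIntegrable_of_Icc hcd.le ?_
      rw [continuousOn_iff_continuous_restrict]
      exact (hk_cont.comp continuous_subtype_val).mul hla
    have hIb : IntervalIntegrable (fun y : ℝ ↦ k y * Real.log ‖f (b + y * I)‖) volume c d := by
      refine ContinuousOn.intervalIntegrable_of_Icc hcd.le ?_
      rw [continuousOn_iff_continuous_restrict]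
      exact (hk_cont.comp continuous_subtype_val).mul hlb
    rw [← intervalIntegral.integral_sub hIa hIb, ← intervalIntegral.integral_const_mul,
      ← intervalIntegral.integral_const_mul]
    refine intervalIntegral.integral_congr fun y _ ↦ ?_
    simp only [hk, hν]
    have hc0 : Real.cosh (π / (2 * η) * (y - y₀)) ^ 2 ≠ 0 := pow_ne_zero _ (Real.cosh_pos _).ne'
    have hπ : π ≠ 0 := Real.pi_pos.ne'
    field_simp
    ring
  -- take imaginary parts
  have hIm := congrArg Complex.im hW
  simp only [sub_im, add_im, neg_im, mul_im, mul_re, I_re, I_im, ofReal_re, ofReal_im,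
    sub_re, add_re, neg_re, zero_mul, mul_zero, sub_zero, zero_sub, add_zero, zero_add,
    mul_one, one_mul, re_ofNat, im_ofNat, neg_zero] at hIm
  rw [hPb, hPt, hR, hL, hQr, hQl, hZ] at hIm
  rw [hT]
  set JA : ℝ := ∫ y : ℝ in c..d, k y * Real.log ‖f (a + y * I)‖ with hJA
  set JB : ℝ := ∫ y : ℝ in c..d, k y * Real.log ‖f (b + y * I)‖ with hJB
  have hπ : π ≠ 0 := Real.pi_pos.ne'
  field_simp
  linear_combination hIm

end FordDetector

end Literature.Analysis.Complex
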